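import Summits.QuantumFields.YangMills.Theorems.DiagonalMirrorRPRTwistLettersDefs
import Summits.QuantumFields.YangMills.Theorems.DiagonalMirrorRPRWilsonDiagonalModelOddTorusChain

/-!
# Sketch (gen 1) — crux-ideate round 2, seat 3 (lens: correlation inequalities / chessboard), crux content of
# ⟨10604⟩ `DiagonalMirrorRPR` as it now lives under door B of ⟨27398⟩ `WeakCouplingHypercubicLimitRP`

HONEST FRAMING: ideation only; ⟨10604⟩ / ⟨27398⟩ stay OPEN; nothing here proves the Yang–Mills mass gap, the crux, or
R1/R2.  Sorries occur ONLY in the named stubs `stub_sheared_le_unsheared`, `stub_movingDictionary`; every other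
declaration is proved.

WHAT THIS FILE TYPES (answer to idea-crit-9 g12's (c-a) "state the transfer theorem OR say precisely which extra input"):

* §1 (concrete, on the LANDED (A) kernel objects `stepKernelU` / `layerHaar` / `diagCyclicTraceU`): the SHEARED cyclic
  traces `Tr(A^m R^c)` of Wilson's symmetric-chart kernel (`shearedCyclicTraceU`) and the letter `TiltedShearFlat`:
  "shearing a lukewarm swap-RP tilted torus costs exponentially little relative free energy".  This is the EXTRA INPUT,
  in free-energy currency, that turns biaxial clustering into R1's physical half `L_b`.
* §2 (model level, PROVED): R1 may be consumed in THERMAL currency — `OddThermalGap 𝔪 → OddTwistGap 𝔪`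
  (`oddTwistGap_of_oddThermalGap`): an exponentially decaying odd-sector thermal trace beyond the lukewarm time pins
  the sup of the odd sector exactly (rate preserved).
* §3 (model level + parity labels, PROVED): the thermal split `L_a(th) ∧ L_b(th) ∧ R2 ⇒ OddThermalGap`
  (`oddThermalGap_of_split`): U-odd = (E-odd, principal sign +) ⊔ (E-even, principal sign −); the second family is
  sign-defective hence below `e^{−γ a_k}·top` (seat 1's `PrincipalSignGap`, thermalised by `DiagLukewarm`).
* §4 the transfer: `TiltedShearFlat ∧ DiagLukewarm ⇒ L_b(th)` (`eOddThermalGap_of_shearFlat`, PROVED modulo the ONE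
  owed dictionary `stub_movingDictionary` = the hands' operator layer read with momentum labels: E-odd ⊂ moving, and
  moving thermal weight = shear-AVERAGED deficit of tilted partition functions, by character orthogonality on `ℤ/Sℤ`).

References: J. Fröhlich, R. Israel, E. Lieb, B. Simon, Comm. Math. Phys. 62 (1978) 1–34, Thm 2.1 & §3 (45° tori, chessboard);
K. Osterwalder, E. Seiler, Ann. Phys. 110 (1978) 440 §2–3; M. Lüscher, Comm. Math. Phys. 104 (1986) 177 (finite-volume
spectrum / momentum sectors); F. Martinelli, E. Olivieri, R. Schonmann, Comm. Math. Phys. 165 (1994) 33 (weak vs strong mixing).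
-/

noncomputable section

open scoped SchwartzMap
open MeasureTheory Filter Topology
open Literature.MathematicalPhysics.AQFT Literature.MathematicalPhysics.QuantumLattice
open Literature.MathematicalPhysics.QuantumFieldTheory
open Summit.QuantumFields.YangMills.Cruxes.DiagonalMirrorRPR.SignTwistedDiagonalTrace
open Summit.QuantumFields.YangMills.Cruxes.DiagonalMirrorRPR.SignTwistedDiagonalTrace.WilsonDiagonal

namespace Summit.QuantumFields.YangMills.Cruxes.WeakCouplingHypercubicLimitRP.TiltedShearFlatness

set_option autoImplicit false

/-! ## §1 Sheared cyclic traces of Wilson's symmetric-chart kernel, and the letter `TiltedShearFlat` -/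

section Sheared

variable {S : ℕ} [NeZero S]
variable {G : Type} [Group G] [TopologicalSpace G] [IsTopologicalGroup G] [CompactSpace G] [MeasurableSpace G]
  [BorelSpace G] {Nc : ℕ} (ρ : G →* Matrix (Fin Nc) (Fin Nc) ℂ) (β : ℝ)

/-- Slab translation of a layer configuration by `c` units of the symmetric-chart slab coordinate `u = x₀ + x₁`
(the operator `R^c`, `R = W^{(S+1)/2}`: the unit slice translation `W = T(1,1)` shifts `u` by `2`, so `R² = W`,
`R^S = 1`, and `R`-momentum `p` relates to slice momentum `j ∈ (−S/2, S/2)` by `p = j(S+1)/2`; the E-odd sectors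
`j odd` are exactly the `u`-momenta `|p| > S/4`). -/
def layerShiftU (c : ZMod S) (Z : LayerCfg S S G) : LayerCfg S S G :=
  fun p => Z ((p.1.1 + c, p.1.2), p.2)

/-- **Sheared cyclic trace** `Tr(A^m R^c)`: the `m`-fold cyclic `K_u`-chain closed up through the slab translation by
`c`.  For even `m = 2t` it is the partition function of the TILTED torus `Λ_{t,c}` with period lattice
`⟨S(e₀+e₁), t(e₀−e₁) + (shear c), S e₂, S e₃⟩` — a homogeneous lattice quotient, swap-symmetric iff `c = 0`
(then it is `diagCyclicTraceU ρ β (2t) = Tr A^{2t}`, the swap-RP tilted torus of FILS Thm 2.1). -/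
def shearedCyclicTraceU (m : ℕ) [NeZero m] (c : ZMod S) : ℝ :=
  ∫ Z : ZMod m → LayerCfg S S G,
    ∏ t : ZMod m, stepKernelU ρ β (Z t) (if t + 1 = 0 then layerShiftU c (Z (t + 1)) else Z (t + 1))
    ∂(Measure.pi fun _ : ZMod m => layerHaar S S G)

/-- Sheared cyclic traces are non-negative (positive kernel). -/
theorem shearedCyclicTraceU_nonneg (m : ℕ) [NeZero m] (c : ZMod S) :
    0 ≤ shearedCyclicTraceU (S := S) (G := G) ρ β m c :=
  integral_nonneg fun _ => Finset.prod_nonneg fun _ _ => (stepKernelU_pos ρ β _ _).le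

/-- `stub_sheared_le_unsheared` (S; swap-RP Cauchy–Schwarz on the tilted torus — the "sign for free" half):
`Tr(A^{2t+2} R^c) ≤ Tr(A^{2t+2})` (`R = layerShiftU 1`, the unit shift of the chart coordinate `u = x₀ + x₁ (mod S)`,
`R² = W` the unit slice translation, `R^S = 1`), i.e. the UNSHEARED tilted torus maximises the partition function
among its shears (`|Tr(A^{t+1} R^c A^{t+1})| ≤ ‖A^{t+1}‖²_HS`; equivalently `c ↦ Tr(A^{2t+2}R^c)` is positive-definite
on `ℤ/Sℤ`, Bochner).  At operator level this is immediate from the interface (`DiagonalSliceModel` docstring: `A_k`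
self-adjoint Hilbert–Schmidt, so `A^{2t+2} ⪰ 0`, and `R` unitary commuting); at KERNEL level it is Cauchy–Schwarz in
`L²(layerHaar ⊗ layerHaar)` for the `(t+1)`-step kernel `F`: `Z_c = ∫∫ F(X,Y) F(Y, R^c X) ≤ ∫∫ F² = Z_0`, which needs
`F(X,Y) = F(Y,X)` (the symmetric half-step form of `stepKernelU` that `stub_wilsonDiagonalModel` owes — the kernel as
written is only Θ-pseudo-symmetric) and the `R`-invariance of `layerHaar`.  Same debt as the hands' operator layer, no
new one; recorded as a stub, not used below.  Cheapest falsifier: the 2D Ising toy (`decide +kernel`). -/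
theorem stub_sheared_le_unsheared (_hβ : 0 ≤ β) (t : ℕ) (c : ZMod S) :
    shearedCyclicTraceU (S := S) (G := G) ρ β (2 * t + 2) c ≤
      shearedCyclicTraceU (S := S) (G := G) ρ β (2 * t + 2) 0 := by
  sorry

end Sheared

section Letter

variable {G : Type} [Group G] [TopologicalSpace G] [IsTopologicalGroup G] [CompactSpace G] [MeasurableSpace G]
  [BorelSpace G] (r : LatticeRep G) (sch : SpeciesScheme (YMSpecies G))

/-- **Letter `TiltedShearFlat r sch γ θ C`** (free-energy currency; the extra input of (c-a)).  Eventually in `k`, for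
every temporal extent `t + 1 ≥ θ · side_k` (lukewarm) and every shear `c ∈ ℤ/side_k ℤ`, the relative partition-function
DEFICIT of the sheared tilted torus is exponentially small in the extent beyond the lukewarm time:
`Z(Λ_{t+1,0}) − Z(Λ_{t+1,c}) ≤ C · exp(−2γ a_k (t − θ side_k)) · Z(Λ_{t+1,0})`.
Physically: translation twists of a massive phase cost no free energy (no momentum condensate); spectrally (given the
owed dictionary of §4) it says every slab-momentum `≠ 0` sector of `S = A²` lies below `e^{−2γ a_k}·top²` in thermal
form — STRONGER than R1's physical half `L_b` (E-odd ⊂ moving), equally true in a massive theory, and stated on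
objects (partition functions of homogeneous swap-RP tori, NO observables) immune to the `c_k`-amplification transport
problem P3.  It FAILS for `G = U(1)` at weak coupling (massless photon: deficit `O(1)` at `t ≍ side_k`), exactly where
`RPSpectral` fails too. -/
def TiltedShearFlat (γ θ C : ℝ) : Prop :=
  ∀ᶠ k in atTop, ∀ t : ℕ, θ * (sch.side k : ℝ) ≤ (t : ℝ) → ∀ c : ZMod (sch.side k),
    shearedCyclicTraceU (S := sch.side k) (G := G) r.ρ (sch.β k) (2 * t + 2) 0 -
        shearedCyclicTraceU (S := sch.side k) (G := G) r.ρ (sch.β k) (2 * t + 2) c ≤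
      C * Real.exp (-(2 * γ * sch.a k * ((t : ℝ) - θ * sch.side k))) *
        shearedCyclicTraceU (S := sch.side k) (G := G) r.ρ (sch.β k) (2 * t + 2) 0

end Letter

/-! ## §2 R1 in thermal currency: `OddThermalGap ⇒ OddTwistGap` (proved) -/

section Thermal

variable {G : Type} [Group G] [TopologicalSpace G] [IsTopologicalGroup G] [CompactSpace G]
  [MeasurableSpace G] [BorelSpace G] {r : LatticeRep G} {sch : SpeciesScheme (YMSpecies G)}

/-- **R1 (thermal form) `OddThermalGap`**: for some rate `γ > 0`, lukewarm fraction `θ` and constant `C`, eventually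
in `k`, the `U`-odd thermal trace `Σ_j (sm_j/top)^{2t+2}` is `≤ C e^{−2γ a_k (t − θ side_k)}` for every `t ≥ θ side_k`.
Implied by `OddTwistGap ∧ DiagLukewarm`; implies `OddTwistGap` (below) — so the core may consume R1 in this currency. -/
def OddThermalGap (𝔪 : DiagonalSliceModel r sch) : Prop :=
  ∃ γ : ℝ, 0 < γ ∧ ∃ θ C : ℝ, ∀ᶠ k in atTop, ∀ t : ℕ, θ * (sch.side k : ℝ) ≤ (t : ℝ) →
    ∑' j, (𝔪.sm k j / 𝔪.top k) ^ (2 * t + 2) ≤ C * Real.exp (-(2 * γ * sch.a k * ((t : ℝ) - θ * sch.side k)))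

/-- Summability of the normalised odd-sector powers `(sm_j/top)^{2t+2}` (from `summable_sm`, `sm ≤ top`). -/
theorem summable_sm_div_pow (𝔪 : DiagonalSliceModel r sch) (k t : ℕ) :
    Summable fun j => (𝔪.sm k j / 𝔪.top k) ^ (2 * t + 2) := by
  have htop : 0 < 𝔪.top k := 𝔪.top_pos k
  have hx0 : ∀ j, 0 ≤ 𝔪.sm k j / 𝔪.top k := fun j => div_nonneg (𝔪.sm_nonneg k j) htop.le
  have hx1 : ∀ j, 𝔪.sm k j / 𝔪.top k ≤ 1 := fun j => (div_le_one htop).2 (𝔪.sm_le k j)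
  have hbase : Summable fun j => (𝔪.sm k j / 𝔪.top k) ^ 2 := by
    have := (𝔪.summable_sm k).div_const (𝔪.top k ^ 2)
    refine this.congr fun j => ?_
    rw [div_pow]
  refine Summable.of_nonneg_of_le (fun j => pow_nonneg (hx0 j) _) (fun j => ?_) hbase
  calc (𝔪.sm k j / 𝔪.top k) ^ (2 * t + 2) = (𝔪.sm k j / 𝔪.top k) ^ (2 * t) * (𝔪.sm k j / 𝔪.top k) ^ 2 := by
        rw [← pow_add]
    _ ≤ 1 * (𝔪.sm k j / 𝔪.top k) ^ 2 := by
        gcongr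
        exact pow_le_one₀ (hx0 j) (hx1 j)
    _ = (𝔪.sm k j / 𝔪.top k) ^ 2 := one_mul _

/-- **R1 thermal ⇒ R1 spectral** (rate preserved): if the odd thermal trace decays like `e^{−2γ a_k t}` beyond the
lukewarm time, then EVERY odd-sector eigenvalue is `≤ e^{−γ a_k} · top` — a single state above that level would make
`(sm_j / (e^{−γ a_k} top))^{2t+2}` unbounded in `t`. -/
theorem oddTwistGap_of_oddThermalGap (𝔪 : DiagonalSliceModel r sch) (h : OddThermalGap 𝔪) : OddTwistGap 𝔪 := by
  obtain ⟨γ, hγ, θ, C, hev⟩ := h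
  refine ⟨γ, hγ, ?_⟩
  filter_upwards [hev] with k hk
  intro j
  have htop : 0 < 𝔪.top k := 𝔪.top_pos k
  set q : ℝ := Real.exp (-(γ * sch.a k)) with hq_def
  have hq : 0 < q := Real.exp_pos _
  by_contra hcon
  push Not at hcon
  -- the offending normalised eigenvalue `x = sm_j / top > q`
  set x : ℝ := 𝔪.sm k j / 𝔪.top k with hx_def
  have hqx : q < x := by
    rw [hx_def, lt_div_iff₀ htop]
    exact hcon
  have hx : 0 < x := hq.trans hqx
  -- the thermal bound in the form `x^(2t+2) ≤ K * q^(2t+2)` for `t ≥ θ side_k`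
  set K : ℝ := C * Real.exp (2 * γ * sch.a k * θ * sch.side k + 2 * γ * sch.a k) with hK_def
  have hkey : ∀ t : ℕ, θ * (sch.side k : ℝ) ≤ (t : ℝ) → x ^ (2 * t + 2) ≤ K * q ^ (2 * t + 2) := by
    intro t ht
    have h1 : x ^ (2 * t + 2) ≤ ∑' j', (𝔪.sm k j' / 𝔪.top k) ^ (2 * t + 2) :=
      (summable_sm_div_pow 𝔪 k t).le_tsum j
        (fun j' _ => pow_nonneg (div_nonneg (𝔪.sm_nonneg k j') htop.le) _)
    have h2 := hk t ht
    have h3 : C * Real.exp (-(2 * γ * sch.a k * ((t : ℝ) - θ * sch.side k))) = K * q ^ (2 * t + 2) := by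
      rw [hK_def, hq_def, ← Real.exp_nat_mul, mul_assoc C, ← Real.exp_add]
      congr 1
      congr 1
      push_cast
      ring
    linarith [h1, h2, h3.le, h3.ge]
  -- hence `(x/q)^(2t+2) ≤ K` for all large `t`, contradicting `x/q > 1`
  have hρ : 1 < x / q := (one_lt_div hq).2 hqx
  have hlim : Tendsto (fun t : ℕ => (x / q) ^ (2 * t + 2)) atTop atTop := by
    have h2t : Tendsto (fun t : ℕ => 2 * t + 2) atTop atTop :=
      tendsto_atTop_atTop.2 fun b => ⟨b, fun t ht => by omega⟩
    exact (tendsto_pow_atTop_atTop_of_one_lt hρ).comp h2t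
  have hev1 : ∀ᶠ t : ℕ in atTop, K < (x / q) ^ (2 * t + 2) := hlim.eventually_gt_atTop K
  have hev2 : ∀ᶠ t : ℕ in atTop, θ * (sch.side k : ℝ) ≤ (t : ℝ) := by
    obtain ⟨n, hn⟩ := exists_nat_ge (θ * (sch.side k : ℝ))
    filter_upwards [eventually_ge_atTop n] with t ht
    exact hn.trans (by exact_mod_cast ht)
  obtain ⟨t, ht1, ht2⟩ := (hev1.and hev2).exists
  have h4 := hkey t ht2
  have hqpow : 0 < q ^ (2 * t + 2) := pow_pos hq _
  have h5 : (x / q) ^ (2 * t + 2) ≤ K := by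
    rw [div_pow, div_le_iff₀ hqpow]
    exact h4
  linarith

end Thermal

/-! ## §3 The thermal split: `L_a(th) ∧ L_b(th) ∧ R2 ⇒ OddThermalGap` (proved) -/

section Split

variable {G : Type} [Group G] [TopologicalSpace G] [IsTopologicalGroup G] [CompactSpace G]
  [MeasurableSpace G] [BorelSpace G] {r : LatticeRep G} {sch : SpeciesScheme (YMSpecies G)}

/-- **Parity labels** on the `U`-odd states of a diagonal slice model: `eodd k j` says the `j`-th `U`-odd state at step
`k` is ODD under the principal parity `E = R_prᵀ W^{(S+1)/2}` of TwistSplit #109 (`= (−1)^{j}` on slice momentum `j ∈ (−S/2,S/2)`, `R_pr` a principal square root of `W`).  Since `U = sgn(K_pr) · E`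
(`A = K_pr E`, `K_pr = K R_pr⁻¹ = A E` the principal step), a `U`-odd state is either
E-odd with principal sign `+` (PHYSICAL family, `L_b`) or E-even with principal sign `−` (SIGN-DEFECTIVE family, `L_a`).
Posited data (the hands' spectral layer exposes no momentum decomposition yet); no axiom beyond decidability. -/
structure ParityLabels (𝔪 : DiagonalSliceModel r sch) where
  /-- the `j`-th `U`-odd state at step `k` is `E`-odd -/
  eodd : ℕ → ℕ → Prop
  /-- decidability, to write indicator sums -/
  dec : ∀ k j, Decidable (eodd k j)

attribute [instance] ParityLabels.dec

/-- **`L_a` thermalised = seat 1's `PrincipalSignGap` in label currency**: eventually, every `U`-odd state that is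
E-EVEN (hence principal-sign-defective) lies below `e^{−γ a_k} · top`. (Cutoff-scale letter; NOT claimed here.) -/
def PrincipalSignGapL (𝔪 : DiagonalSliceModel r sch) (lab : ParityLabels 𝔪) (γ : ℝ) : Prop :=
  ∀ᶠ k in atTop, ∀ j, ¬ lab.eodd k j → 𝔪.sm k j ≤ Real.exp (-(γ * sch.a k)) * 𝔪.top k

/-- **`L_b` in thermal currency**: eventually, for `t ≥ θ side_k`, the E-ODD part of the `U`-odd thermal trace is
`≤ C e^{−2γ a_k (t − θ side_k)}`.  (Physical letter; §4 supplies it from `TiltedShearFlat`.) -/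
def EOddThermalGap (𝔪 : DiagonalSliceModel r sch) (lab : ParityLabels 𝔪) (γ θ C : ℝ) : Prop :=
  ∀ᶠ k in atTop, ∀ t : ℕ, θ * (sch.side k : ℝ) ≤ (t : ℝ) →
    ∑' j, (if lab.eodd k j then (𝔪.sm k j / 𝔪.top k) ^ (2 * t + 2) else 0) ≤
      C * Real.exp (-(2 * γ * sch.a k * ((t : ℝ) - θ * sch.side k)))

/-- The odd-sector half of `DiagLukewarm` (drop the non-negative even-sector sum). -/
def SmLukewarm (𝔪 : DiagonalSliceModel r sch) (θ C : ℝ) : Prop :=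
  ∀ᶠ k in atTop, ∀ t : ℕ, θ * (sch.side k : ℝ) ≤ (t : ℝ) → ∑' j, (𝔪.sm k j / 𝔪.top k) ^ (2 * t) ≤ C

theorem smLukewarm_of_diagLukewarm (𝔪 : DiagonalSliceModel r sch) (h : DiagLukewarm 𝔪) :
    ∃ θ : ℝ, 0 < θ ∧ θ < 1 / 2 ∧ ∃ C : ℝ, SmLukewarm 𝔪 θ C := by
  obtain ⟨θ, hθ, hθ', C, hev⟩ := h
  refine ⟨θ, hθ, hθ', C, ?_⟩
  filter_upwards [hev] with k hk
  intro t ht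
  have hsp : 0 ≤ ∑' j, (𝔪.sp k j / 𝔪.top k) ^ (2 * t) :=
    tsum_nonneg fun j => pow_nonneg (div_nonneg (𝔪.sp_nonneg k j) (𝔪.top_pos k).le) _
  linarith [hk t ht]

/-- **The thermal split** (`U`-odd = E-odd ⊔ sign-defective): `L_a(th) ∧ L_b(th) ∧ R2(odd half) ⇒ R1(th)`, with the
same rate `γ` and lukewarm fraction `θ ≥ 0`, constant `C₁ + C₂`.  The sign-defective family is bounded termwise by
`(e^{−γ a_k})^{2t+2−2t₀} · (sm_j/top)^{2t₀}` at the lukewarm time `t₀ = max 1 ⌈θ side_k⌉`, and summed by R2. -/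
theorem oddThermalGap_of_split (𝔪 : DiagonalSliceModel r sch) (lab : ParityLabels 𝔪) {γ θ C₁ C₂ : ℝ}
    (hγ : 0 < γ) (hθ : 0 ≤ θ) (hLa : PrincipalSignGapL 𝔪 lab γ) (hLb : EOddThermalGap 𝔪 lab γ θ C₁)
    (hR2 : SmLukewarm 𝔪 θ C₂) : OddThermalGap 𝔪 := by
  refine ⟨γ, hγ, θ, C₁ + C₂, ?_⟩
  filter_upwards [hLa, hLb, hR2] with k hka hkb hk2
  intro t ht
  have htop : 0 < 𝔪.top k := 𝔪.top_pos k
  have ha : 0 < sch.a k := sch.a_pos k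
  set q : ℝ := Real.exp (-(γ * sch.a k)) with hq_def
  have hq : 0 < q := Real.exp_pos _
  set x : ℕ → ℝ := fun j => 𝔪.sm k j / 𝔪.top k with hx_def
  have hx0 : ∀ j, 0 ≤ x j := fun j => div_nonneg (𝔪.sm_nonneg k j) htop.le
  -- lukewarm time `t₀ = max 1 ⌈θ side_k⌉`, `θ side_k ≤ t₀ ≤ θ side_k + 1`, `t₀ ≤ t + 1`
  set t₀ : ℕ := max 1 ⌈θ * (sch.side k : ℝ)⌉₊ with ht₀_def
  have hθs : 0 ≤ θ * (sch.side k : ℝ) := by positivity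
  have ht₀ : θ * (sch.side k : ℝ) ≤ (t₀ : ℝ) :=
    (Nat.le_ceil _).trans (by rw [ht₀_def]; exact_mod_cast le_max_right _ _)
  have ht₀' : (t₀ : ℝ) ≤ θ * (sch.side k : ℝ) + 1 := by
    have h1 := Nat.ceil_lt_add_one hθs
    rcases le_total 1 ⌈θ * (sch.side k : ℝ)⌉₊ with hle | hle
    · have : t₀ = ⌈θ * (sch.side k : ℝ)⌉₊ := by rw [ht₀_def]; exact max_eq_right hle
      rw [this]; linarith
    · have : t₀ = 1 := by rw [ht₀_def]; exact max_eq_left hle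
      rw [this]; push_cast; linarith
  have ht₀t : t₀ ≤ t + 1 := by
    have hceil : ⌈θ * (sch.side k : ℝ)⌉₊ ≤ t := Nat.ceil_le.2 ht
    rw [ht₀_def]; omega
  have ht₀pos : 1 ≤ t₀ := le_max_left _ _
  obtain ⟨s, hs⟩ : ∃ s, t₀ = s + 1 := ⟨t₀ - 1, by omega⟩
  -- termwise: odd term ≤ E-odd indicator + defective term
  have hsplit : ∀ j, x j ^ (2 * t + 2) ≤
      (if lab.eodd k j then x j ^ (2 * t + 2) else 0) + q ^ (2 * t + 2 - 2 * t₀) * x j ^ (2 * t₀) := by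
    intro j
    by_cases hj : lab.eodd k j
    · simp only [hj, ↓reduceIte]
      have : 0 ≤ q ^ (2 * t + 2 - 2 * t₀) * x j ^ (2 * t₀) := mul_nonneg (pow_nonneg hq.le _) (pow_nonneg (hx0 j) _)
      linarith
    · simp only [hj, ↓reduceIte, zero_add]
      have hxq : x j ≤ q := by
        show 𝔪.sm k j / 𝔪.top k ≤ q
        rw [div_le_iff₀ htop]
        exact hka j hj
      calc x j ^ (2 * t + 2) = x j ^ (2 * t + 2 - 2 * t₀) * x j ^ (2 * t₀) := by
            rw [← pow_add]; congr 1; omega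
        _ ≤ q ^ (2 * t + 2 - 2 * t₀) * x j ^ (2 * t₀) :=
            mul_le_mul_of_nonneg_right (pow_le_pow_left₀ (hx0 j) hxq _) (pow_nonneg (hx0 j) _)
  have hsumE : Summable fun j => (if lab.eodd k j then x j ^ (2 * t + 2) else 0) := by
    refine Summable.of_nonneg_of_le (fun j => ?_) (fun j => ?_) (summable_sm_div_pow 𝔪 k t)
    · split_ifs
      · exact pow_nonneg (hx0 j) _
      · exact le_rfl
    · split_ifs
      · exact le_rfl
      · exact pow_nonneg (hx0 j) _
  have hsum0 : Summable fun j => x j ^ (2 * t₀) := by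
    have : Summable fun j => x j ^ (2 * s + 2) := summable_sm_div_pow 𝔪 k s
    refine this.congr fun j => ?_
    rw [hs]; ring_nf
  have hsumD : Summable fun j => q ^ (2 * t + 2 - 2 * t₀) * x j ^ (2 * t₀) := hsum0.mul_left _
  have hle : ∑' j, x j ^ (2 * t + 2) ≤
      ∑' j, (if lab.eodd k j then x j ^ (2 * t + 2) else 0) +
        q ^ (2 * t + 2 - 2 * t₀) * ∑' j, x j ^ (2 * t₀) := by
    rw [← tsum_mul_left, ← hsumE.tsum_add hsumD]
    exact Summable.tsum_le_tsum hsplit (summable_sm_div_pow 𝔪 k t) (hsumE.add hsumD)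
  -- the three ingredients
  have hE : ∑' j, (if lab.eodd k j then x j ^ (2 * t + 2) else 0) ≤
      C₁ * Real.exp (-(2 * γ * sch.a k * ((t : ℝ) - θ * sch.side k))) := hkb t ht
  have hD : ∑' j, x j ^ (2 * t₀) ≤ C₂ := hk2 t₀ ht₀
  have hC₂ : 0 ≤ C₂ := (tsum_nonneg fun j => pow_nonneg (hx0 j) _).trans hD
  have hqm : q ^ (2 * t + 2 - 2 * t₀) ≤ Real.exp (-(2 * γ * sch.a k * ((t : ℝ) - θ * sch.side k))) := by
    rw [hq_def, ← Real.exp_nat_mul, Real.exp_le_exp]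
    have hm : 2 * ((t : ℝ) - θ * sch.side k) ≤ ((2 * t + 2 - 2 * t₀ : ℕ) : ℝ) := by
      have : ((2 * t + 2 - 2 * t₀ : ℕ) : ℝ) = 2 * (t : ℝ) + 2 - 2 * (t₀ : ℝ) := by
        rw [Nat.cast_sub (by omega)]; push_cast; ring
      rw [this]; linarith
    have hγa : 0 ≤ γ * sch.a k := by positivity
    nlinarith
  calc ∑' j, (𝔪.sm k j / 𝔪.top k) ^ (2 * t + 2) = ∑' j, x j ^ (2 * t + 2) := rfl
    _ ≤ C₁ * Real.exp (-(2 * γ * sch.a k * ((t : ℝ) - θ * sch.side k))) +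
          Real.exp (-(2 * γ * sch.a k * ((t : ℝ) - θ * sch.side k))) * C₂ := by
        refine hle.trans (add_le_add hE ?_)
        exact mul_le_mul hqm hD (tsum_nonneg fun j => pow_nonneg (hx0 j) _) (Real.exp_pos _).le
    _ = (C₁ + C₂) * Real.exp (-(2 * γ * sch.a k * ((t : ℝ) - θ * sch.side k))) := by ring

end Split

/-! ## §4 The transfer: `TiltedShearFlat ∧ R2 ⇒ L_b(th)` modulo the ONE owed dictionary -/

section Transfer

variable {G : Type} [Group G] [TopologicalSpace G] [IsTopologicalGroup G] [CompactSpace G]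
  [MeasurableSpace G] [BorelSpace G] {r : LatticeRep G} {sch : SpeciesScheme (YMSpecies G)}

/-- **The moving dictionary** (OWED: the hands' operator layer read with slab-momentum labels).  Eventually in `k`,
for every `t`: (i) the unsheared trace is the model's full even trace `Tr A^{2t+2} = Σ sp^{2t+2} + Σ sm^{2t+2}`
(hands: `HasSum (κ_i^{m}) (diagCyclicTraceU … m)`, and `shearedCyclicTraceU … 0 = diagCyclicTraceU …`); (ii) the E-ODD
part of the `U`-odd trace is at most the MOVING thermal weight, which equals the shear-averaged deficit
`Z(Λ_{t+1,0}) − (1/S) Σ_c Z(Λ_{t+1,c})` (joint diagonalisation of `A` and the slab translation `W`; E-odd ⊂ momentum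
`≠ 0` because `E = R^S = +1` on `W`-fixed vectors; character orthogonality `Σ_{c ∈ ℤ/Sℤ} cos(2π c p/S) = S·[p = 0]`). -/
def MovingDictionary (𝔪 : DiagonalSliceModel r sch) (lab : ParityLabels 𝔪) : Prop :=
  ∀ᶠ k in atTop, ∀ t : ℕ,
    shearedCyclicTraceU (S := sch.side k) (G := G) r.ρ (sch.β k) (2 * t + 2) 0 =
        ∑' j, 𝔪.sp k j ^ (2 * t + 2) + ∑' j, 𝔪.sm k j ^ (2 * t + 2) ∧
      ∑' j, (if lab.eodd k j then 𝔪.sm k j ^ (2 * t + 2) else 0) ≤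
        shearedCyclicTraceU (S := sch.side k) (G := G) r.ρ (sch.β k) (2 * t + 2) 0 -
          (∑ c : ZMod (sch.side k), shearedCyclicTraceU (S := sch.side k) (G := G) r.ρ (sch.β k) (2 * t + 2) c) /
            (sch.side k : ℝ)

variable (r sch) in
/-- `stub_movingDictionary` (M–L; = the hands' (A) deliverable `wilsonDiagonalModel` ENRICHED with parity labels
satisfying the moving dictionary).  Existence of a labelled diagonal slice model of Wilson's measure obeying
`MovingDictionary`.  Owed content beyond (A): the slab translation as a unitary commuting with `A_k`, momentum sectors,
`E = R_prᵀ W^{(S+1)/2} = (−1)^{j}` on slice-momentum sector `j ∈ (−S/2, S/2)` (TwistSplit #109's parity), and the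
sheared-trace formula `Tr(A^{2t+2} R^c) = Σ_i κ_i^{2t+2} cos(2π c p_i / S)` (`p_i` the `u`-momentum of `ψ_i`).  CAVEAT: the
split of §3 is valid for ANY labelling; it has teeth only for THIS one (with `eodd ≡ False` it degenerates to `L_a = R1`),
so this stub must be discharged with the spectral labels, not a convenient relabelling. -/
theorem stub_movingDictionary (hβ : ∀ᶠ k in atTop, 0 ≤ sch.β k) :
    ∃ 𝔪 : DiagonalSliceModel r sch, ∃ lab : ParityLabels 𝔪, MovingDictionary 𝔪 lab := by
  sorry

/-- Indicator of a quotient power is the indicator of the power, divided. -/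
theorem ite_div_pow (p : Prop) [Decidable p] (a b : ℝ) (n : ℕ) :
    (if p then (a / b) ^ n else 0) = (if p then a ^ n else 0) / b ^ n := by
  split_ifs
  · rw [div_pow]
  · rw [zero_div]

/-- **The transfer** `TiltedShearFlat ∧ R2 ⇒ L_b(th)` (PROVED modulo the dictionary): for every shear the deficit is
`≤ ε Z₀`, hence so is the shear-AVERAGED deficit = the moving weight ≥ the E-odd weight; normalise by
`Z₀ = top^{2t+2} · (normalised full trace) ≤ C₂ top^{2t+2}` (R2 at `t + 1`). -/
theorem eOddThermalGap_of_shearFlat (𝔪 : DiagonalSliceModel r sch) (lab : ParityLabels 𝔪)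
    (hdict : MovingDictionary 𝔪 lab) {γ θ C C₂ : ℝ} (hC : 0 ≤ C) (hflat : TiltedShearFlat r sch γ θ C)
    (hR2 : ∀ᶠ k in atTop, ∀ t : ℕ, θ * (sch.side k : ℝ) ≤ (t : ℝ) →
      ∑' j, (𝔪.sp k j / 𝔪.top k) ^ (2 * t) + ∑' j, (𝔪.sm k j / 𝔪.top k) ^ (2 * t) ≤ C₂) :
    EOddThermalGap 𝔪 lab γ θ (C * C₂) := by
  filter_upwards [hdict, hflat, hR2] with k hkd hkf hk2
  intro t ht
  obtain ⟨htr, hmov⟩ := hkd t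
  have htop : 0 < 𝔪.top k := 𝔪.top_pos k
  set T : ℝ := 𝔪.top k ^ (2 * t + 2) with hT_def
  have hT : 0 < T := pow_pos htop _
  set ε : ℝ := C * Real.exp (-(2 * γ * sch.a k * ((t : ℝ) - θ * sch.side k))) with hε_def
  have hε : 0 ≤ ε := by positivity
  set Z : ZMod (sch.side k) → ℝ :=
    fun c => shearedCyclicTraceU (S := sch.side k) (G := G) r.ρ (sch.β k) (2 * t + 2) c with hZ_def
  have hS : 0 < (sch.side k : ℝ) := by exact_mod_cast Nat.pos_of_ne_zero (NeZero.ne _)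
  -- shear-averaged deficit ≤ ε Z 0
  have hdef : ∀ c, Z 0 - Z c ≤ ε * Z 0 := fun c => hkf t ht c
  have havg : Z 0 - (∑ c, Z c) / (sch.side k : ℝ) ≤ ε * Z 0 := by
    have hsum : ∑ c : ZMod (sch.side k), (Z 0 - Z c) ≤ ∑ c : ZMod (sch.side k), ε * Z 0 :=
      Finset.sum_le_sum fun c _ => hdef c
    rw [Finset.sum_const, Finset.card_univ, ZMod.card, Finset.sum_sub_distrib, Finset.sum_const, Finset.card_univ,
      ZMod.card, nsmul_eq_mul, nsmul_eq_mul] at hsum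
    have h2 : Z 0 - (∑ c, Z c) / (sch.side k : ℝ) = ((sch.side k : ℝ) * Z 0 - ∑ c, Z c) / (sch.side k : ℝ) := by
      field_simp
    rw [h2, div_le_iff₀ hS]
    linarith [hsum, mul_comm (sch.side k : ℝ) (ε * Z 0)]
  -- R2 at `t + 1`: `Z 0 = T · (normalised trace) ≤ C₂ T`
  have hR2' : ∑' j, (𝔪.sp k j / 𝔪.top k) ^ (2 * t + 2) + ∑' j, (𝔪.sm k j / 𝔪.top k) ^ (2 * t + 2) ≤ C₂ := by
    have := hk2 (t + 1) (ht.trans (by push_cast; linarith))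
    simpa [show 2 * (t + 1) = 2 * t + 2 by ring] using this
  have hZT : Z 0 = T * (∑' j, (𝔪.sp k j / 𝔪.top k) ^ (2 * t + 2) + ∑' j, (𝔪.sm k j / 𝔪.top k) ^ (2 * t + 2)) := by
    rw [show Z 0 = _ from htr]
    simp_rw [div_pow]
    rw [tsum_div_const, tsum_div_const, mul_add, mul_div_cancel₀ _ hT.ne', mul_div_cancel₀ _ hT.ne']
  have hZle : Z 0 ≤ C₂ * T := by
    rw [hZT, mul_comm]
    exact mul_le_mul_of_nonneg_right hR2' hT.le
  -- assemble
  have hgoal : (∑' j, (if lab.eodd k j then 𝔪.sm k j ^ (2 * t + 2) else 0)) / T ≤ ε * C₂ := by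
    rw [div_le_iff₀ hT]
    calc ∑' j, (if lab.eodd k j then 𝔪.sm k j ^ (2 * t + 2) else 0) ≤ Z 0 - (∑ c, Z c) / (sch.side k : ℝ) := hmov
      _ ≤ ε * Z 0 := havg
      _ ≤ ε * (C₂ * T) := mul_le_mul_of_nonneg_left hZle hε
      _ = ε * C₂ * T := by ring
  calc ∑' j, (if lab.eodd k j then (𝔪.sm k j / 𝔪.top k) ^ (2 * t + 2) else 0)
      = (∑' j, (if lab.eodd k j then 𝔪.sm k j ^ (2 * t + 2) else 0)) / T := by
        simp_rw [ite_div_pow]; rw [tsum_div_const]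
    _ ≤ ε * C₂ := hgoal
    _ = C * C₂ * Real.exp (-(2 * γ * sch.a k * ((t : ℝ) - θ * sch.side k))) := by rw [hε_def]; ring

/-- **Door B, re-lettered (this seat's (c-a) answer, composed)**: the THREE letters
`L_a(th)` (`PrincipalSignGapL`, cutoff-scale, seat 1), `TiltedShearFlat` (physical, free-energy currency, this seat) and
`DiagLukewarm` (R2) give R1 `OddTwistGap` on any labelled model obeying the moving dictionary — kernel-checked modulo
`stub_movingDictionary` (hands' operator layer) only. -/
theorem oddTwistGap_of_letters (𝔪 : DiagonalSliceModel r sch) (lab : ParityLabels 𝔪)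
    (hdict : MovingDictionary 𝔪 lab) {γ θ C : ℝ} (hγ : 0 < γ) (hθ : 0 ≤ θ) (hC : 0 ≤ C)
    (hLa : PrincipalSignGapL 𝔪 lab γ) (hflat : TiltedShearFlat r sch γ θ C)
    (hR2 : ∃ C₂ : ℝ, ∀ᶠ k in atTop, ∀ t : ℕ, θ * (sch.side k : ℝ) ≤ (t : ℝ) →
      ∑' j, (𝔪.sp k j / 𝔪.top k) ^ (2 * t) + ∑' j, (𝔪.sm k j / 𝔪.top k) ^ (2 * t) ≤ C₂) :
    OddTwistGap 𝔪 := by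
  obtain ⟨C₂, hk2⟩ := hR2
  have hLb : EOddThermalGap 𝔪 lab γ θ (C * C₂) := eOddThermalGap_of_shearFlat 𝔪 lab hdict hC hflat hk2
  have hsm : SmLukewarm 𝔪 θ C₂ := by
    filter_upwards [hk2] with k hk
    intro t ht
    have hsp : 0 ≤ ∑' j, (𝔪.sp k j / 𝔪.top k) ^ (2 * t) :=
      tsum_nonneg fun j => pow_nonneg (div_nonneg (𝔪.sp_nonneg k j) (𝔪.top_pos k).le) _
    linarith [hk t ht]
  exact oddTwistGap_of_oddThermalGap 𝔪 (oddThermalGap_of_split 𝔪 lab hγ hθ hLa hLb hsm)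

end Transfer


/-! ## §5  The dictionary in FINITE DIMENSIONS (PROVED, no sorry, no commutation hypotheses)

What `stub_movingDictionary` (ii) and `stub_sheared_le_unsheared` assert, for matrices: with `B = A^{2t+2} = MᵀM`
(`A` symmetric), `E` a symmetric involution fixing the `R`-invariant vectors (`E P₀ = P₀`, `P₀` the symmetric idempotent
onto them — in the model `P₀ = (1/S) Σ_c R^c`), and `U` orthogonal:
* `eOdd_weight_le_moving_weight : Tr(B (1−E)/2) ≤ Tr B − Tr(B P₀)`   (E-odd weight ≤ moving weight = shear-averaged deficit),
* `trace_pow_mul_orthogonal_le : Tr(B U) ≤ Tr B`                        (sheared ≤ unsheared; `U = R^c`),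
* `trace_mul_avg_pow : Tr(B · (1/S)Σ_{c<S} R^c) = (1/S) Σ_{c<S} Tr(B R^c)` (the average IS the projection).
So the owed content of the two stubs is ONLY the operator ↔ kernel passage for Wilson's `stepKernelU` (Hilbert–Schmidt,
symmetric half-step form) and the spectral reading of the labels — the inequalities themselves are kernel-checked here. -/

namespace FinDim

open Matrix

variable {n : Type} [Fintype n] [DecidableEq n]

omit [DecidableEq n] in
/-- `Tr(Xᵀ X) ≥ 0`. -/
theorem trace_transpose_mul_self_nonneg (X : Matrix n n ℝ) : 0 ≤ (Xᵀ * X).trace := by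
  simp only [Matrix.trace, Matrix.diag, Matrix.mul_apply, Matrix.transpose_apply]
  exact Finset.sum_nonneg fun i _ => Finset.sum_nonneg fun j _ => mul_self_nonneg _

omit [DecidableEq n] in
/-- `Tr(Mᵀ M Q) ≥ 0` for a symmetric idempotent `Q` (no commutation needed: `Tr(BQ) = Tr(Q B Q)`). -/
theorem trace_gram_mul_proj_nonneg (M Q : Matrix n n ℝ) (hQ : Qᵀ = Q) (hQ2 : Q * Q = Q) :
    0 ≤ (Mᵀ * M * Q).trace := by
  have h1 : Mᵀ * M * Q = (Mᵀ * M * Q) * Q := by rw [Matrix.mul_assoc (Mᵀ * M), hQ2]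
  have h2 : ((Mᵀ * M * Q) * Q).trace = (Q * (Mᵀ * M * Q)).trace := Matrix.trace_mul_comm _ _
  have h3 : Q * (Mᵀ * M * Q) = (M * Q)ᵀ * (M * Q) := by
    rw [Matrix.transpose_mul, hQ]; simp only [Matrix.mul_assoc]
  rw [h1, h2, h3]
  exact trace_transpose_mul_self_nonneg _

/-- **Finite-dimensional moving dictionary.**  `A` symmetric, `E` a symmetric involution, `P₀` a symmetric idempotent
(the projection onto the translation-fixed vectors) with `E P₀ = P₀` ("`E = +1` on fixed vectors"); NO commutation
with `A` is needed for the inequality (it is `Tr(B Q) = Tr(Q B Q) ≥ 0` for `B = A^{2t+2} ⪰ 0`, `Q = (1+E)/2 − P₀`).  Then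
the E-odd thermal weight is dominated by the moving thermal weight:
`Tr(A^{2t+2} (1−E)/2) ≤ Tr(A^{2t+2}) − Tr(A^{2t+2} P₀)`. -/
theorem eOdd_weight_le_moving_weight (A E P₀ : Matrix n n ℝ) (t : ℕ) (hA : Aᵀ = A) (hE : Eᵀ = E)
    (hE2 : E * E = 1) (hP : P₀ᵀ = P₀) (hP2 : P₀ * P₀ = P₀) (hEP : E * P₀ = P₀) :
    (A ^ (2 * t + 2) * ((2 : ℝ)⁻¹ • (1 - E))).trace ≤ (A ^ (2 * t + 2)).trace - (A ^ (2 * t + 2) * P₀).trace := by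
  -- `P₀ E = P₀` from the transpose of `E P₀ = P₀`
  have hPE : P₀ * E = P₀ := by
    have := congrArg Matrix.transpose hEP
    simpa only [Matrix.transpose_mul, hE, hP] using this
  set Q : Matrix n n ℝ := (2 : ℝ)⁻¹ • (1 + E) - P₀ with hQdef
  have hQ : Qᵀ = Q := by
    simp only [hQdef, Matrix.transpose_sub, Matrix.transpose_smul, Matrix.transpose_add, Matrix.transpose_one, hE, hP]
  have hQ2 : Q * Q = Q := by
    simp only [hQdef, Matrix.sub_mul, Matrix.mul_sub, Matrix.smul_mul, Matrix.mul_smul, Matrix.add_mul,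
      Matrix.mul_add, Matrix.one_mul, Matrix.mul_one, hE2, hEP, hPE, hP2, smul_add, smul_sub]
    module
  set M : Matrix n n ℝ := A ^ (t + 1) with hMdef
  have hM : A ^ (2 * t + 2) = Mᵀ * M := by
    rw [hMdef, Matrix.transpose_pow, hA, ← pow_add]; ring_nf
  have key : (A ^ (2 * t + 2)).trace - (A ^ (2 * t + 2) * P₀).trace
      - (A ^ (2 * t + 2) * ((2 : ℝ)⁻¹ • (1 - E))).trace = (Mᵀ * M * Q).trace := by
    rw [hM, ← Matrix.trace_sub, ← Matrix.trace_sub]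
    congr 1
    simp only [hQdef, Matrix.mul_sub, Matrix.mul_smul, Matrix.mul_add, Matrix.mul_one, smul_sub, smul_add]
    module
  have := trace_gram_mul_proj_nonneg M Q hQ hQ2
  linarith

/-- The shear average is the projection: `(1/S) Σ_{c<S} Tr(B R^c) = Tr(B P₀)` when `P₀ = (1/S) Σ_{c<S} R^c`. -/
theorem trace_mul_avg_pow (B R : Matrix n n ℝ) (S : ℕ) :
    (B * ((S : ℝ)⁻¹ • ∑ c ∈ Finset.range S, R ^ c)).trace
      = (S : ℝ)⁻¹ * ∑ c ∈ Finset.range S, (B * R ^ c).trace := by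
  rw [Matrix.mul_smul, Matrix.trace_smul, Matrix.mul_sum, Matrix.trace_sum, smul_eq_mul]

/-- **Finite-dimensional "sheared ≤ unsheared".**  For symmetric `A` and orthogonal `U` (no commutation needed):
`Tr(A^{2t+2} U) ≤ Tr(A^{2t+2})` — `Tr B − Tr(BU) = ½ Tr(Xᵀ X)` with `B = Mᵀ M`, `M = A^{t+1}`, `X = M(1 − U)`. -/
theorem trace_pow_mul_orthogonal_le (A U : Matrix n n ℝ) (t : ℕ) (hA : Aᵀ = A) (hU : U * Uᵀ = 1) :
    (A ^ (2 * t + 2) * U).trace ≤ (A ^ (2 * t + 2)).trace := by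
  set M : Matrix n n ℝ := A ^ (t + 1) with hMdef
  have hM : A ^ (2 * t + 2) = Mᵀ * M := by
    rw [hMdef, Matrix.transpose_pow, hA, ← pow_add]; ring_nf
  rw [hM]
  -- `Tr(B U) = Tr(B Uᵀ)` for symmetric `B`
  have hsym : (Mᵀ * M * U).trace = (Mᵀ * M * Uᵀ).trace := by
    rw [← Matrix.trace_transpose (Mᵀ * M * U), Matrix.transpose_mul, Matrix.transpose_mul,
      Matrix.transpose_transpose, Matrix.trace_mul_comm]
  -- `Tr(Xᵀ X) = Tr(B (1−U)(1−U)ᵀ) = 2 Tr B − Tr(BU) − Tr(BUᵀ)`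
  have hX : ((M * (1 - U))ᵀ * (M * (1 - U))).trace
      = 2 * (Mᵀ * M).trace - (Mᵀ * M * U).trace - (Mᵀ * M * Uᵀ).trace := by
    have h1 : ((M * (1 - U))ᵀ * (M * (1 - U))).trace = (Mᵀ * M * ((1 - U) * (1 - U)ᵀ)).trace := by
      rw [Matrix.transpose_mul, Matrix.trace_mul_comm, ← Matrix.mul_assoc, Matrix.trace_mul_comm]
      simp only [Matrix.mul_assoc]
    have h2 : (1 - U) * (1 - U)ᵀ = (2 : ℝ) • (1 : Matrix n n ℝ) - U - Uᵀ := by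
      rw [Matrix.transpose_sub, Matrix.transpose_one, Matrix.sub_mul, Matrix.mul_sub, Matrix.mul_sub,
        Matrix.one_mul, Matrix.one_mul, Matrix.mul_one, hU, two_smul]
      abel
    rw [h1, h2, Matrix.mul_sub, Matrix.mul_sub, Matrix.trace_sub, Matrix.trace_sub, Matrix.mul_smul,
      Matrix.trace_smul, Matrix.mul_one, smul_eq_mul]
  have hnn := trace_transpose_mul_self_nonneg (M * (1 - U))
  rw [hX, ← hsym] at hnn
  linarith

end FinDim

end Summit.QuantumFields.YangMills.Cruxes.WeakCouplingHypercubicLimitRP.TiltedShearFlatness
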